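import Summits.Ventures.QEC.Census.CertBZPlaneSeg2
import Summits.Ventures.QEC.Census.CertInfoSet
import Summits.Ventures.QEC.Census.BZAutPerm
import Summits.Ventures.QEC.Census.CertCheckMitm
import HarnessLib

/-!
# The TWO-BLOCK SHIFT lane for abelian two-block CSS distance certificates — definitions, checks, engine glue

Venture QEC (cell `qec`), qec-type-01 gen 5 (census KERNEL-upgrade lane, director-qec R33; INTENT 01.TBSHIFT).

SETTING. One side of a CSS certificate on `n` qubits: syndrome rows `Hsyn`, stabilizer rows `Hstab` (commuting), an
allow-list `found` of low-weight stabilizers with their row decompositions, threshold `wmax = d − 1`. The qubits split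
into two BLOCKS `B₁ = [0, ℓ)` and `B₂ = [ℓ, n)`; a group of code automorphisms (the block translations of an abelian
two-block / generalized-bicycle code, given as qec-type-12 `AutGen` tables and words) maps every qubit of a block to ONE
fixed free qubit `p₀` of that block while preserving the blocks.

THE ARGUMENT (elementary). A logical `c` (`Hsyn c = 0`, `c ∉ rowspace Hstab`) of weight `≤ wmax` has `≤ ⌊wmax/2⌋`
support points in one of the two blocks (pigeonhole) — the LIGHT block `L` of one of the two HALVES below. If it has
none there, `c` is an XOR of the kernel-basis words (qec-search-7 `kerVec`, `eq_ofBits_freeSupp`) of the free columns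
OUTSIDE `L` — a member of the explicit list `subXors` of those (`2^δ` words, `δ` small when the other block's circulant has
nearly full rank), checked one by one (`zeroCaseOK`). Otherwise translate `c` so that `p₀ ∈ supp c` (same weight, still a
non-trivial logical: qec-search-4 `orbit_transport`); with an RREF of `Hsyn` whose pivots prefer the heavy block, `c` is
`kerVec p₀ ⊕ z ⊕ (≤ ⌊wmax/2⌋ − 1 further light free-column words)`, `z ∈ subXors(heavy free columns)`: for every `z` ONE
forced-top-row lane family of qec-type-01's engine (`TopReaches`, from `Plane.segOK` / `Plane.seg2OK` parts on the matrix
`lightRows ++ [kerVec p₀ ⊕ z]`) certifies weight `> wmax` or allow-listed. Conclusion (companion file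
`CertTwoBlockShiftSound.lean`): the flat `lowZ` hypothesis of qec-type-10's `DistCert.isCode_of_onesided_lower`.

COST. Per half and per `z`: `C(|light free columns| − 1, ≤ ⌊wmax/2⌋ − 1)` lanes instead of the certificate's
`C(K, ≤ t)` information-set enumeration — e.g. `[[132,4,14]]` (`ℓ = 66`, `δ = 2`): `7.3·10⁷` lanes instead of `3.3·10⁸`.
HONEST FRAMING: infrastructure; no certificate is read and no distance is asserted here; no gain when `δ` is large.
Tier KERNEL, axioms standard, no `native_decide`. [folklore] (pigeonhole over the two circulant blocks + transitivity of the
translation group; automorphism reduction of low-weight enumeration as in Grassl 2006 §2.2.)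
-/

set_option autoImplicit false

namespace Summit.Ventures.QEC.Census

open List

/-! ## Forced-top-row selections -/

/-- **Top selections of a matrix with a forced extra row.** Every sub-selection `S` of `≤ t` rows of `G` (as a sub-list of
the engine's position list `rowPos G 0`), XOR-ed onto the forced row `g` (selection bit `2^|G|`), passes `test`.
(definition) -/
def TopReaches (test : ℕ → ℕ → Bool) (G : List ℕ) (g : ℕ) (t : ℕ) : Prop :=
  ∀ S : List (ℕ × ℕ), S.Sublist (rowPos G 0) → S.length ≤ t →
    test (xorFst S ^^^ 2 ^ G.length) (xorSnd S ^^^ g) = true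

namespace Plane

/-- Index-position pairs of `G ++ [g]` read those of `G` below `|G|`. -/
theorem map_pair_append_eq (G : List ℕ) (g : ℕ) (J : List ℕ) (hJ : ∀ j ∈ J, j < G.length) :
    (J.map fun j => (2 ^ j, (G ++ [g]).getD j 0)) = J.map fun j => (2 ^ j, G.getD j 0) := by
  refine List.map_congr_left fun j hj => ?_
  rw [List.getD_eq_getElem?_getD, List.getD_eq_getElem?_getD, List.getElem?_append_left (hJ j hj)]

/-- The forced row's pair. -/
theorem pair_top (G : List ℕ) (g : ℕ) : ((2 : ℕ) ^ G.length, (G ++ [g]).getD G.length 0) = (2 ^ G.length, g) := by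
  rw [List.getD_eq_getElem?_getD, List.getElem?_append_right (le_refl _), Nat.sub_self, List.getElem?_cons_zero,
    Option.getD_some]

/-- From a sub-list of `rowPos G 0` of length `≤ t` to the sorted index list `J ++ [|G|]` of `G ++ [g]` and back:
the common part of the two glue theorems below. -/
theorem topReaches_of_cover (test : ℕ → ℕ → Bool) (G : List ℕ) (g : ℕ) (t : ℕ)
    (h : ∀ J : List ℕ, J.Pairwise (· < ·) → (∀ j ∈ J, j < G.length) → J.length ≤ t →
      test (xorFst ((J ++ [G.length]).map fun j => (2 ^ j, (G ++ [g]).getD j 0)))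
        (xorSnd ((J ++ [G.length]).map fun j => (2 ^ j, (G ++ [g]).getD j 0))) = true) :
    TopReaches test G g t := by
  intro S hS hlen
  obtain ⟨J, hJsub, rfl⟩ := exists_map_of_sublist_rowPos G hS
  have hJp : J.Pairwise (· < ·) := List.Pairwise.sublist hJsub List.pairwise_lt_range
  have hJlt : ∀ j ∈ J, j < G.length := fun j hj => List.mem_range.1 (hJsub.subset hj)
  rw [List.length_map] at hlen
  have := h J hJp hJlt hlen
  rw [List.map_append, List.map_singleton, pair_top, map_pair_append_eq G g J hJlt, xorFst_append, xorSnd_append]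
    at this
  simpa [xorFst, xorSnd, xorList] using this

/-- **Glue (one plain segment).** If the rows of `G ++ [g]` are words below `2^n` and the segment of largest row `|G|`
at depth `t + 1` passes (`segOK n wmax allow (G ++ [g]) (t+1) |G| 1 fuel`: all selections `S ∪ {|G|}`, `|S| ≤ t`), then
`TopReaches (bzLeaf wmax allow) G g t`. -/
theorem topReaches_of_seg (n wmax : ℕ) (allow G : List ℕ) (g : ℕ) (t fuel : ℕ) (hG : ∀ x ∈ G ++ [g], x < 2 ^ n)
    (hseg : segOK n wmax allow (G ++ [g]) (t + 1) G.length 1 fuel = true) :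
    TopReaches (bzLeaf wmax allow) G g t := by
  refine topReaches_of_cover _ G g t fun J hJp hJlt hJl => ?_
  have hJp' : (J ++ [G.length]).Pairwise (· < ·) := by
    rw [List.pairwise_append]
    exact ⟨hJp, List.pairwise_singleton _ _, fun j hj m hm => by
      rw [List.mem_singleton] at hm; subst hm; exact hJlt j hj⟩
  have hJlt' : ∀ j ∈ J ++ [G.length], j < (G ++ [g]).length := fun j hj => by
    rw [List.length_append, List.length_singleton]
    rcases List.mem_append.1 hj with h | h
    · have := hJlt j h; omega
    · rw [List.mem_singleton] at h; omega
  obtain ⟨b, hb, hbits⟩ := covers_segment (t + 1) G.length 1 (le_refl _) (by omega) J hJp hJlt (by omega)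
  rw [segOK] at hseg
  exact leaf_of_familyOK_covers n wmax allow (G ++ [g]) fuel hG _ hseg _ hJp' hJlt' hb hbits

/-- **Glue (second-row parts).** If the rows of `G ++ [g]` are words below `2^n`, the singleton family of row `|G|` passes
(`segOK … 1 |G| 1`), and for every `p < |G|` some listed range `(p₀, q) ∋ p` has a passing second-row family
`seg2OK n wmax allow (G ++ [g]) (t+1) |G| p₀ q fuel` (selections `S ∪ {p, |G|}`, `|S| ≤ t − 1`), then
`TopReaches (bzLeaf wmax allow) G g t`. -/
theorem topReaches_of_seg2 (n wmax : ℕ) (allow G : List ℕ) (g : ℕ) (t fuel : ℕ) (hG : ∀ x ∈ G ++ [g], x < 2 ^ n)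
    (hsing : segOK n wmax allow (G ++ [g]) 1 G.length 1 fuel = true)
    (ranges : List (ℕ × ℕ))
    (hcov : ((List.range G.length).all fun p => ranges.any fun r => decide (r.1 ≤ p) && decide (p < r.1 + r.2)) = true)
    (hpairs : ∀ r ∈ ranges, seg2OK n wmax allow (G ++ [g]) (t + 1) G.length r.1 r.2 fuel = true) :
    TopReaches (bzLeaf wmax allow) G g t := by
  refine topReaches_of_cover _ G g t fun J hJp hJlt hJl => ?_
  have hJp' : (J ++ [G.length]).Pairwise (· < ·) := by
    rw [List.pairwise_append]
    exact ⟨hJp, List.pairwise_singleton _ _, fun j hj m hm => by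
      rw [List.mem_singleton] at hm; subst hm; exact hJlt j hj⟩
  have hJlt' : ∀ j ∈ J ++ [G.length], j < (G ++ [g]).length := fun j hj => by
    rw [List.length_append, List.length_singleton]
    rcases List.mem_append.1 hj with h | h
    · have := hJlt j h; omega
    · rw [List.mem_singleton] at h; omega
  rcases List.eq_nil_or_concat J with rfl | ⟨J', p, rfl⟩
  · -- the forced row alone
    rw [segOK] at hsing
    obtain ⟨b, hb, hbits⟩ := covers_segment 1 G.length 1 (le_refl _) (by omega) [] List.Pairwise.nil
      (fun _ h => by simp at h) (by simp)
    exact leaf_of_familyOK_covers n wmax allow (G ++ [g]) fuel hG _ hsing _ hJp' hJlt' hb hbits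
  · -- a second-largest row `p < |G|`
    rw [List.concat_eq_append] at hJp hJlt hJl hJp' hJlt' ⊢
    have hpG : p < G.length := hJlt p (by simp)
    have hJ'p : J'.Pairwise (· < ·) := (List.pairwise_append.1 hJp).1
    have hJ'lt : ∀ j ∈ J', j < p := fun j hj => (List.pairwise_append.1 hJp).2.2 j hj p (List.mem_singleton_self p)
    have hJ'l : J'.length ≤ t + 1 - 2 := by
      rw [List.length_append, List.length_singleton] at hJl; omega
    simp only [List.all_eq_true, List.mem_range, List.any_eq_true, Bool.and_eq_true, decide_eq_true_eq] at hcov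
    obtain ⟨r, hr, h1, h2⟩ := hcov p hpG
    obtain ⟨b, hb, hbits⟩ := covers_seg2 (t + 1) G.length r.1 r.2 h1 h2 hpG J' hJ'p hJ'lt hJ'l
    have hok := hpairs r hr
    rw [seg2OK] at hok
    exact leaf_of_familyOK_covers n wmax allow (G ++ [g]) fuel hG _ hok _ hJp' hJlt' hb hbits

end Plane

/-! ## All sub-XORs of a word list -/

/-- All XORs of sub-lists of a word list (`2^|l|` words, with repetitions). (definition) -/
def subXors : List ℕ → List ℕ
  | [] => [0]
  | g :: gs => subXors gs ++ (subXors gs).map fun x => g ^^^ x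

/-- The XOR of a sub-list is listed. -/
theorem xorList_mem_subXors {S l : List ℕ} (h : S.Sublist l) : xorList S ∈ subXors l := by
  induction h with
  | slnil => simp [subXors, xorList]
  | cons g _ ih => exact List.mem_append_left _ ih
  | cons_cons g _ ih => exact List.mem_append_right _ (List.mem_map.2 ⟨_, ih, rfl⟩)

/-! ## The data of the lane and its Bool checks -/

/-- One HALF of the shift lane: the light block is `[lo, hi)`; an RREF certificate of the syndrome rows (pivots preferring
the other block); the forced free column `p₀ ∈ [lo, hi)`; one automorphism word per light column `lo + i` mapping it to
`p₀`. (structure) -/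
structure ShiftHalf where
  /-- light block `[lo, hi)` -/
  lo : ℕ
  /-- light block `[lo, hi)` -/
  hi : ℕ
  /-- RREF certificate of `Hsyn` (qec-search-7 `InfoSetCert`: pivots, reduced rows, decompositions) -/
  ic : InfoSetCert
  /-- the forced free column of the light block -/
  p0 : ℕ
  /-- `words[i]` maps qubit `lo + i` to `p₀` (a word in the generator tables) -/
  words : List (List ℕ)

namespace ShiftHalf

variable (h : ShiftHalf)

/-- In the light block? (definition) -/
def inL (q : ℕ) : Bool := decide (h.lo ≤ q) && decide (q < h.hi)

/-- The light rows: kernel-basis words of the free light columns other than `p₀`, increasing column order. (definition) -/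
def lightCols (n : ℕ) : List ℕ :=
  (List.range n).filter fun q => h.inL q && !(h.ic.piv.elem q) && !(q == h.p0)

/-- The heavy free columns. (definition) -/
def heavyCols (n : ℕ) : List ℕ := (List.range n).filter fun q => !(h.inL q) && !(h.ic.piv.elem q)

/-- The enumeration matrix of the half (without the forced row). (definition) -/
def lightRows (n : ℕ) : List ℕ := (h.lightCols n).map (kerVec h.ic.piv h.ic.red)

/-- The coset words `z`: all sub-XORs of the heavy free columns' kernel words. (definition) -/
def zList (n : ℕ) : List ℕ := subXors ((h.heavyCols n).map (kerVec h.ic.piv h.ic.red))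

/-- The forced row for coset word `z`. (definition) -/
def topRow (z : ℕ) : ℕ := kerVec h.ic.piv h.ic.red h.p0 ^^^ z

/-- One word table maps `p` to `p₀` and preserves the light block (hence its complement). (definition) -/
def tabOK (n : ℕ) (tab : List ℕ) (p : ℕ) : Bool :=
  (permFun tab p == h.p0) && (List.range n).all fun q => h.inL q == h.inL (permFun tab q)

/-- **The structural check of a half**: `lo ≤ hi ≤ n`; the RREF certificate checks against `Hsyn`; `p₀` is a free column of
the light block; one word per light column, in the generators, whose table maps the column to `p₀` and preserves the
light block. (definition, `decide`) -/
def structOK (n : ℕ) (Hsyn : List ℕ) (gens : List AutGen) : Bool :=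
  decide (h.lo ≤ h.hi) && decide (h.hi ≤ n) && infoSetStructOK n Hsyn h.ic &&
    (h.inL h.p0 && !(h.ic.piv.elem h.p0) && decide (h.p0 < n)) &&
    (h.words.length == h.hi - h.lo) && autWordsOK gens.length h.words &&
    (List.range (h.hi - h.lo)).all fun i => h.tabOK n (wordPerm n (autPerms gens) (h.words.getD i [])) (h.lo + i)

/-- **The empty-light-block check**: every coset word is `0`, or has weight `> wmax`, or is allow-listed. (definition) -/
def zeroCaseOK (n wmax : ℕ) (allow : List ℕ) : Bool :=
  (h.zList n).all fun z => (z == 0) || wtGt wmax z || allow.elem z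

end ShiftHalf

/-- The lane's data for one side: generators, the two halves, the light budget `t` (emitter `emit_shift_row.py`). (structure) -/
structure ShiftSide where
  /-- automorphism generators (qec-type-12 `AutGen`) -/
  gens : List AutGen
  /-- half with light block `B₁` -/
  A : ShiftHalf
  /-- half with light block `B₂` -/
  B : ShiftHalf
  /-- light budget: `wmax ≤ 2t + 1` -/
  t : ℕ

/-- **The two-half check**: both halves' structural checks, complementary light blocks on `[0, n)`, and the budget
inequality `wmax ≤ 2t + 1`. (definition, `decide`) -/
def ShiftSide.structOK (s : ShiftSide) (n : ℕ) (Hsyn : List ℕ) (wmax : ℕ) : Bool :=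
  s.A.structOK n Hsyn s.gens && s.B.structOK n Hsyn s.gens &&
    ((List.range n).all fun q => s.B.inL q == !(s.A.inL q)) && decide (wmax ≤ 2 * s.t + 1)

/-! ## Controls (tier KERNEL, `decide`) -/

/-- `subXors` on two words lists the four sub-XORs. -/
theorem subXors_pair : subXors [1, 2] = [0, 2, 1, 3] := by decide

/-- The Steane matrix of `Census/CertBZPlane.lean` with its last row forced: every selection of `≤ 1` of the first three
rows XOR-ed onto row `3` has weight `≥ 3` — by one plain segment, and again by the singleton + one second-row range. -/
theorem topReaches_steane :
    TopReaches (bzLeaf 2 []) (Plane.steaneG.take 3) (Plane.steaneG.getD 3 0) 1 ∧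
      Plane.segOK 7 2 [] (Plane.steaneG.take 3 ++ [Plane.steaneG.getD 3 0]) 2 3 1 1 = true :=
  ⟨Plane.topReaches_of_seg 7 2 [] (Plane.steaneG.take 3) (Plane.steaneG.getD 3 0) 1 1 (by decide) (by decide),
    by decide⟩

/-- The same control through the second-row glue. -/
theorem topReaches_steane_seg2 :
    TopReaches (bzLeaf 2 []) (Plane.steaneG.take 3) (Plane.steaneG.getD 3 0) 1 ∧
      Plane.seg2OK 7 2 [] (Plane.steaneG.take 3 ++ [Plane.steaneG.getD 3 0]) 2 3 0 3 1 = true :=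
  ⟨Plane.topReaches_of_seg2 7 2 [] (Plane.steaneG.take 3) (Plane.steaneG.getD 3 0) 1 1 (by decide) (by decide) [(0, 3)] (by decide)
      (by intro r hr; simp only [List.mem_singleton] at hr; subst hr; decide),
    by decide⟩

end Summit.Ventures.QEC.Census
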